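import Summits.Langlands.Langlands.Theorems.RamifiedCoefficientSeedAdjointLiftingGL3BirthDefs4
import Summits.Langlands.Langlands.Theorems.RamifiedCoefficientSeedAdjointLiftingGL3StubLocalShapeWildHelpers
import Literature.NumberTheory.GaloisRepresentations.SerreWeightShapeProofs
import Literature.NumberTheory.GaloisRepresentations.TameInertiaProofs
import Literature.NumberTheory.GaloisRepresentations.RamificationFiltrationProofs
import Literature.NumberTheory.GaloisRepresentations.GlobalArtinMapOfCharactersProofs
import Literature.NumberTheory.GaloisRepresentations.CalegariEvenFontaineMazurTwo
import HarnessLib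

/-!
# Crux `AdjointLiftingGL3` (stmt-Langlands-16779), line `birth`: CORE-B `stub_localShapeWild`
# (the wild case of the local Fontaine–Laffaille stub S2a, from conjunct (ii) of (F13))

Setting (`…BirthDefs4`): `K` a non-archimedean local field with `#𝓀[K] = p ≥ 11`,
`k = ℤ̄_p/𝔪 = padicAlgClResidueField p`, `V : Γ_K → GL₂(k)` and `χ : Γ_K → GL₁(k)` with open kernels,
`T = P₀ (χ · Ad⁰ V) P₀⁻¹` (`IsTwistedAdZero`), Fontaine–Laffaille data `FLDataAt K p T ι ϖ hϖ {0,1,2}`,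
`χ|_I = ω⁻¹` (`InertialCharEq`) and a wild frame `P` of `V` (`WildFrameOf`: `V` not tame, `P V P⁻¹`
upper triangular on `Γ_K` with inertial diagonal `(ω^{s+e}, ω^s)`, `e = ±1`).  Conclusion:
`LocalShapeT K p V ι ϖ hϖ` (level one: `P V(σ) P⁻¹ = ω(σ)^s (ω(σ) c; 0 1)` on `I_K` and `V = 1` on
every `I_K^u`, `u > 1`).

Proof.  Write `U = P V P⁻¹ = (a c; 0 b)`.  In the basis `(E, H, F)` of `ad⁰` the matrix of
`Ad⁰(U)` is upper triangular with diagonal `(a/b, 1, b/a)` and `(E,H)`-entry `-2c/b`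
(`adZero_entries_of_upperTriangular` of the helpers file `…StubLocalShapeWildHelpers.lean`, from the accepted `coe_glAdZeroTwoFrame_apply`), so in the
frame `R = Π · Ad⁰(P) · P₀⁻¹` (`Π` the transposition of the first two basis vectors) the reduction
`T` is upper triangular on `Γ_K` with middle `2 × 2` block `χ · (a/b, -2c/b; 0, 1)`
(`frame_entries`).  On `I_K^u`, `u > 0`, the diagonal characters `a, b, χ` are trivial (their
values have `p`-power order: `absUpperInertia_map_isPGroup_holds`), so the middle block is the
unipotent `(1, -2c(σ); 0, 1)`; a simultaneous diagonalisation of the middle block over `Γ_K` would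
make these trivial, i.e. `c = 0` and `V = 1` on every `I_K^u`, `u > 0` — `V` tame, excluded: the
block is NON-SPLIT.  Its inertial diagonal is `(ω^{-1} ω^{e}, ω^{-1}) = (ω^{-b}, ω^{-a})` with
`a = 1`, `b = 1 - e ∈ {0, 2} ⊂ {0,1,2}`, so conjunct (ii) of (F13) gives `b < a` — excluding
`e = -1` — and, for `e = 1` (`a = b + 1`), that the block is trivial on every `I_K^v`, `v > 1`,
whence `c = 0` and `V = 1` there (`p ≠ 2`); with `U = ω^s (ω, c/ω^s; 0, 1)` on `I_K` this is
`LocalShapeT`.  No `sorry`, no new definition, no named fact.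

References: Gee–Herzig–Liu–Savitt, Doc. Math. 22 (2017), Prop. 2.3.1 and Examples 2.1.4 (1);
Clozel–Harris–Taylor, Publ. IHÉS 108, Lemma 2.4.2; Serre, Duke Math. J. 54 (1987), §2.4. -/

set_option linter.dupNamespace false -- `Summit.Langlands.Langlands` is the mandated namespace

noncomputable section

namespace Summit.Langlands.Langlands.Cruxes.AdjointLiftingGL3.Birth

open scoped MatrixGroups NumberField Valued
open NumberField IsDedekindDomain Field Filter ValuativeRel
open Literature.NumberTheory.GaloisRepresentations Literature.NumberTheory.PAdicHodge
open Literature.NumberTheory.GaloisRepresentations.IsNonarchimedeanLocalField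

section Main

/-- **CORE-B (stub S2a, second local half): the wild case from conjunct (ii) of (F13).**  Let `K`
be a non-archimedean local field with `#𝓀[K] = p ≥ 11`, `V`, `χ` with open kernels,
`T = χ ⊗ ad⁰ V` (`IsTwistedAdZero`), `FLDataAt K p T ι ϖ hϖ {0,1,2}`, `χ|_I = ω⁻¹` (`InertialCharEq`)
and a wild frame of `V` (`WildFrameOf`).  Then `LocalShapeT K p V ι ϖ hϖ`: in the frame
`Π · Ad⁰(P) · P₀⁻¹` the reduction `T` is upper triangular on `Γ_K` with middle block
`χ · (a/b, -2c/b; 0, 1)`, non-split because `V` is not tame, of inertial diagonal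
`(ω^{e-1}, ω^{-1})`; (ii) excludes `e = -1` (`2 < 1`) and makes the block trivial on every `I_K^v`,
`v > 1`, for `e = 1`, whence `c = 0` and `V = 1` there; with `P V P⁻¹ = ω^s (ω, c/ω^s; 0, 1)` on
`I_K` this is the level-one shape. [cite: GeeHerzigLiuSavitt2017, Prop. 2.3.1 and Examples 2.1.4 (1)]
[cite: ClozelHarrisTaylor2008, Lemma 2.4.2] [cite: Serre1987, §2.4] -/
theorem stub_localShapeWild :
    ∀ (p : ℕ) [Fact p.Prime], 11 ≤ p →
      ∀ (K : Type) [Field K] [ValuativeRel K] [TopologicalSpace K] [IsNonarchimedeanLocalField K],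
        residueFieldCard K = p →
        ∀ (V : absoluteGaloisGroup K →* GL (Fin 2) (padicAlgClResidueField p))
          (χ : absoluteGaloisGroup K →* GL (Fin 1) (padicAlgClResidueField p))
          (T : absoluteGaloisGroup K →* GL (Fin 3) (padicAlgClResidueField p)),
          IsOpen (V.ker : Set (absoluteGaloisGroup K)) → IsOpen (χ.ker : Set (absoluteGaloisGroup K)) →
          IsTwistedAdZero T V χ →
          ∀ (ι : absIntegers (↥(ValuativeRel.valuation K).integer) K ⧸ absMaximalIdeal K →+*
                padicAlgClResidueField p)
            (ϖ : ↥(ValuativeRel.valuation K).integer) (hϖ : Irreducible ϖ),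
            FLDataAt K p T ι ϖ hϖ {0, 1, 2} → InertialCharEq K p χ ι ϖ hϖ → WildFrameOf K p V ι ϖ hϖ →
              LocalShapeT K p V ι ϖ hϖ := by
  intro p _ hp K _ _ _ _ _hq V χ T hV hχ hT ι ϖ hϖ hFL hE hW
  classical
  -- the coefficient field `k = ℤ̄_p/𝔪`, discrete
  letI : TopologicalSpace (padicAlgClResidueField p) := ⊥
  haveI : DiscreteTopology (padicAlgClResidueField p) := ⟨rfl⟩
  haveI : IsTopologicalRing (padicAlgClResidueField p) :=
    { continuous_add := continuous_of_discreteTopology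
      continuous_mul := continuous_of_discreteTopology
      continuous_neg := continuous_of_discreteTopology }
  haveI hcp : CharP (padicAlgClResidueField p) p := charP_padicAlgClResidueField p
  haveI : Fact (ringChar 𝓀[K]).Prime := ⟨ringChar_residueField_prime⟩
  haveI hcq : CharP (padicAlgClResidueField p) (ringChar 𝓀[K]) := charP_of_residueEmbedding ι
  have h2 : (2 : padicAlgClResidueField p) ≠ 0 := by
    intro h
    have h' : ((2 : ℕ) : padicAlgClResidueField p) = 0 := by exact_mod_cast h
    rw [@CharP.cast_eq_zero_iff _ _ p hcp] at h'
    have := Nat.le_of_dvd two_pos h'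
    omega
  obtain ⟨⟨u₀, hu₀, σw, hσw, hne⟩, P, s, e, he, htri, hdiag⟩ := hW
  obtain ⟨P₀, hP₀⟩ := hT
  set ω := fundamentalCharacter K 1 ι ϖ hϖ with hω
  have hVc : Continuous V := MonoidHom.continuous_of_isOpen_ker V hV
  have hχc : Continuous χ := MonoidHom.continuous_of_isOpen_ker χ hχ
  /- STEP 1: on `I_K^u`, `u > 0`, the diagonal of `U = P V P⁻¹` and `χ` are trivial
     (`p`-power order, no `p`-torsion in `kˣ`). -/
  have hwild : ∀ {u : ℝ}, 0 < u → ∀ σ ∈ absUpperInertia K u,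
      ((P * V σ * P⁻¹ : GL (Fin 2) (padicAlgClResidueField p)) :
          Matrix (Fin 2) (Fin 2) (padicAlgClResidueField p)) 0 0 = 1 ∧
      ((P * V σ * P⁻¹ : GL (Fin 2) (padicAlgClResidueField p)) :
          Matrix (Fin 2) (Fin 2) (padicAlgClResidueField p)) 1 1 = 1 ∧
      ((χ σ : GL (Fin 1) (padicAlgClResidueField p)) :
          Matrix (Fin 1) (Fin 1) (padicAlgClResidueField p)) 0 0 = 1 := by
    intro u hu σ hσ
    let Vt : absoluteGaloisGroup K →ₜ* GL (Fin 2) (padicAlgClResidueField p) :=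
      ⟨(MulAut.conj P).toMonoidHom.comp V,
        (continuous_of_discreteTopology
          (f := fun A : GL (Fin 2) (padicAlgClResidueField p) => P * A * P⁻¹)).comp hVc⟩
    let χt : absoluteGaloisGroup K →ₜ* GL (Fin 1) (padicAlgClResidueField p) := ⟨χ, hχc⟩
    obtain ⟨j, hj⟩ :=
      absUpperInertia_map_isPGroup_holds K (GL (Fin 2) (padicAlgClResidueField p)) Vt hu
        ⟨Vt σ, ⟨σ, hσ, rfl⟩⟩
    obtain ⟨j', hj'⟩ :=
      absUpperInertia_map_isPGroup_holds K (GL (Fin 1) (padicAlgClResidueField p)) χt hu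
        ⟨χt σ, ⟨σ, hσ, rfl⟩⟩
    have hj2 : (P * V σ * P⁻¹) ^ ringChar 𝓀[K] ^ j = 1 := congrArg Subtype.val hj
    have hj1 : (χ σ) ^ ringChar 𝓀[K] ^ j' = 1 := congrArg Subtype.val hj'
    -- the diagonal characters of the triangular hom `g ↦ P V g P⁻¹`
    set f : absoluteGaloisGroup K →* GL (Fin 2) (padicAlgClResidueField p) :=
      (MulAut.conj P).toMonoidHom.comp V with hf
    have hf10 : ∀ g, (f g : Matrix (Fin 2) (Fin 2) (padicAlgClResidueField p)) 1 0 = 0 := fun g => htri g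
    have hdiag1 : ∀ i : Fin 2,
        ((P * V σ * P⁻¹ : GL (Fin 2) (padicAlgClResidueField p)) :
          Matrix (Fin 2) (Fin 2) (padicAlgClResidueField p)) i i = 1 := by
      intro i
      have hval : (ModPGaloisRep.InertiaShape.diagChar f hf10 i σ : padicAlgClResidueField p) =
          ((P * V σ * P⁻¹ : GL (Fin 2) (padicAlgClResidueField p)) :
            Matrix (Fin 2) (Fin 2) (padicAlgClResidueField p)) i i := rfl
      have hpow : ModPGaloisRep.InertiaShape.diagChar f hf10 i σ ^ ringChar 𝓀[K] ^ j = 1 := by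
        rw [← map_pow]
        ext
        rw [ModPGaloisRep.InertiaShape.coe_diagChar_apply, map_pow]
        change (((P * V σ * P⁻¹) ^ ringChar 𝓀[K] ^ j : GL (Fin 2) (padicAlgClResidueField p)) :
          Matrix (Fin 2) (Fin 2) (padicAlgClResidueField p)) i i = _
        rw [hj2, Matrix.GeneralLinearGroup.coe_one, Matrix.one_apply_eq, Units.val_one]
      have hpow' : (ModPGaloisRep.InertiaShape.diagChar f hf10 i σ : padicAlgClResidueField p) ^
          (ringChar 𝓀[K] ^ j * 1) = 1 := by
        rw [mul_one, ← Units.val_pow_eq_pow_val, hpow, Units.val_one]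
      have := ModPGaloisRep.InertiaShape.pow_eq_one_of_pow_mul_eq_one hpow'
      rwa [pow_one, hval] at this
    refine ⟨hdiag1 0, hdiag1 1, ?_⟩
    have hdet : ((χ σ : GL (Fin 1) (padicAlgClResidueField p)) :
        Matrix (Fin 1) (Fin 1) (padicAlgClResidueField p)) 0 0 ^ (ringChar 𝓀[K] ^ j' * 1) = 1 := by
      rw [mul_one, ← Matrix.det_fin_one ((χ σ : GL (Fin 1) (padicAlgClResidueField p)) :
          Matrix (Fin 1) (Fin 1) (padicAlgClResidueField p)), ← Matrix.det_pow,
        ← Units.val_pow_eq_pow_val, hj1, Units.val_one, Matrix.det_one]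
    have := ModPGaloisRep.InertiaShape.pow_eq_one_of_pow_mul_eq_one hdet
    rwa [pow_one] at this
  /- `V g = 1` as soon as `U g = P V g P⁻¹` has trivial diagonal and `c = 0` -/
  have hV1 : ∀ g : absoluteGaloisGroup K,
      ((P * V g * P⁻¹ : GL (Fin 2) (padicAlgClResidueField p)) :
          Matrix (Fin 2) (Fin 2) (padicAlgClResidueField p)) 0 0 = 1 →
      ((P * V g * P⁻¹ : GL (Fin 2) (padicAlgClResidueField p)) :
          Matrix (Fin 2) (Fin 2) (padicAlgClResidueField p)) 1 1 = 1 →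
      ((P * V g * P⁻¹ : GL (Fin 2) (padicAlgClResidueField p)) :
          Matrix (Fin 2) (Fin 2) (padicAlgClResidueField p)) 0 1 = 0 → V g = 1 := by
    intro g ha hb hc
    have hU : P * V g * P⁻¹ = 1 := by
      refine Units.ext ?_
      ext i j
      fin_cases i <;> fin_cases j
      · simpa using ha
      · simpa using hc
      · simpa using htri g
      · simpa using hb
    have := congrArg (fun M => P⁻¹ * M * P) hU
    simpa [mul_assoc] using this
  /- STEP 2: the frame `R = Π · Ad⁰(P) · P₀⁻¹` and the entries of `R T g R⁻¹`. -/
  set Sw : Matrix (Fin 3) (Fin 3) (padicAlgClResidueField p) := !![0, 1, 0; 1, 0, 0; 0, 0, 1] with hSw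
  have hSS : Sw * Sw = 1 := swap_mul_swap
  set Swgl : GL (Fin 3) (padicAlgClResidueField p) := ⟨Sw, Sw, hSS, hSS⟩ with hSwgl
  set R : GL (Fin 3) (padicAlgClResidueField p) :=
    Swgl * glAdZeroTwoFrame (padicAlgClResidueField p) P * P₀⁻¹ with hRdef
  have hR : ∀ g, ((R * T g * R⁻¹ : GL (Fin 3) (padicAlgClResidueField p)) :
      Matrix (Fin 3) (Fin 3) (padicAlgClResidueField p)) =
      ((χ g : GL (Fin 1) (padicAlgClResidueField p)) :
          Matrix (Fin 1) (Fin 1) (padicAlgClResidueField p)) 0 0 •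
        (Sw * ((glAdZeroTwoFrame (padicAlgClResidueField p) (P * V g * P⁻¹) :
          GL (Fin 3) (padicAlgClResidueField p)) : Matrix (Fin 3) (Fin 3) (padicAlgClResidueField p)) * Sw) := by
    intro g
    have hAd : ((glAdZeroTwoFrame (padicAlgClResidueField p) (P * V g * P⁻¹) :
        GL (Fin 3) (padicAlgClResidueField p)) : Matrix (Fin 3) (Fin 3) (padicAlgClResidueField p)) =
        ((glAdZeroTwoFrame (padicAlgClResidueField p) P : GL (Fin 3) (padicAlgClResidueField p)) : Matrix (Fin 3) (Fin 3) (padicAlgClResidueField p)) *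
          ((adZeroOf V g : GL (Fin 3) (padicAlgClResidueField p)) : Matrix (Fin 3) (Fin 3) (padicAlgClResidueField p)) *
          (((glAdZeroTwoFrame (padicAlgClResidueField p) P)⁻¹ : GL (Fin 3) (padicAlgClResidueField p)) : Matrix (Fin 3) (Fin 3) (padicAlgClResidueField p)) := by
      rw [map_mul, map_mul, map_inv, Matrix.GeneralLinearGroup.coe_mul, Matrix.GeneralLinearGroup.coe_mul]
      rfl
    have hRm : ((R : GL (Fin 3) (padicAlgClResidueField p)) : Matrix (Fin 3) (Fin 3) (padicAlgClResidueField p)) =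
        Sw * ((glAdZeroTwoFrame (padicAlgClResidueField p) P : GL (Fin 3) (padicAlgClResidueField p)) : Matrix (Fin 3) (Fin 3) (padicAlgClResidueField p)) *
          ((P₀⁻¹ : GL (Fin 3) (padicAlgClResidueField p)) : Matrix (Fin 3) (Fin 3) (padicAlgClResidueField p)) := by
      rw [hRdef, Matrix.GeneralLinearGroup.coe_mul, Matrix.GeneralLinearGroup.coe_mul]
    have hRi : ((R⁻¹ : GL (Fin 3) (padicAlgClResidueField p)) : Matrix (Fin 3) (Fin 3) (padicAlgClResidueField p)) =
        ((P₀ : GL (Fin 3) (padicAlgClResidueField p)) : Matrix (Fin 3) (Fin 3) (padicAlgClResidueField p)) *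
          (((glAdZeroTwoFrame (padicAlgClResidueField p) P)⁻¹ : GL (Fin 3) (padicAlgClResidueField p)) : Matrix (Fin 3) (Fin 3) (padicAlgClResidueField p)) *
          Sw := by
      rw [hRdef, mul_inv_rev, mul_inv_rev, inv_inv, Matrix.GeneralLinearGroup.coe_mul,
        Matrix.GeneralLinearGroup.coe_mul, Matrix.mul_assoc]
      rfl
    rw [Matrix.GeneralLinearGroup.coe_mul, Matrix.GeneralLinearGroup.coe_mul, hRm, hRi, hP₀ g, hAd]
    simp only [Matrix.mul_assoc, Matrix.mul_smul, Matrix.smul_mul, Units.inv_mul_cancel_left]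
  -- entries
  have hN : ∀ g,
      ((R * T g * R⁻¹ : GL (Fin 3) (padicAlgClResidueField p)) : Matrix (Fin 3) (Fin 3) (padicAlgClResidueField p)) 1 0 = 0 ∧
      ((R * T g * R⁻¹ : GL (Fin 3) (padicAlgClResidueField p)) : Matrix (Fin 3) (Fin 3) (padicAlgClResidueField p)) 2 0 = 0 ∧
      ((R * T g * R⁻¹ : GL (Fin 3) (padicAlgClResidueField p)) : Matrix (Fin 3) (Fin 3) (padicAlgClResidueField p)) 2 1 = 0 ∧
      ((R * T g * R⁻¹ : GL (Fin 3) (padicAlgClResidueField p)) : Matrix (Fin 3) (Fin 3) (padicAlgClResidueField p)) 0 0 =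
        ((χ g : GL (Fin 1) (padicAlgClResidueField p)) : Matrix (Fin 1) (Fin 1) (padicAlgClResidueField p)) 0 0 *
          (((P * V g * P⁻¹ : GL (Fin 2) (padicAlgClResidueField p)) : Matrix (Fin 2) (Fin 2) (padicAlgClResidueField p)) 0 0 *
            (((P * V g * P⁻¹ : GL (Fin 2) (padicAlgClResidueField p)) : Matrix (Fin 2) (Fin 2) (padicAlgClResidueField p)) 1 1)⁻¹) ∧
      ((R * T g * R⁻¹ : GL (Fin 3) (padicAlgClResidueField p)) : Matrix (Fin 3) (Fin 3) (padicAlgClResidueField p)) 1 1 =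
        ((χ g : GL (Fin 1) (padicAlgClResidueField p)) : Matrix (Fin 1) (Fin 1) (padicAlgClResidueField p)) 0 0 ∧
      ((R * T g * R⁻¹ : GL (Fin 3) (padicAlgClResidueField p)) : Matrix (Fin 3) (Fin 3) (padicAlgClResidueField p)) 0 1 =
        ((χ g : GL (Fin 1) (padicAlgClResidueField p)) : Matrix (Fin 1) (Fin 1) (padicAlgClResidueField p)) 0 0 *
          (-2 * ((P * V g * P⁻¹ : GL (Fin 2) (padicAlgClResidueField p)) : Matrix (Fin 2) (Fin 2) (padicAlgClResidueField p)) 0 1 *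
            (((P * V g * P⁻¹ : GL (Fin 2) (padicAlgClResidueField p)) : Matrix (Fin 2) (Fin 2) (padicAlgClResidueField p)) 1 1)⁻¹) := by
    intro g
    obtain ⟨h00, h01, h10, h11, h20, h21⟩ := adZero_entries_of_upperTriangular (P * V g * P⁻¹) (htri g)
    have hSwc : ∀ (N : Matrix (Fin 3) (Fin 3) (padicAlgClResidueField p)) (r c : Fin 3),
        (Sw * N * Sw) r c = N (Equiv.swap (0 : Fin 3) 1 r) (Equiv.swap (0 : Fin 3) 1 c) := by
      intro N r c
      rw [hSw]
      exact swap_conj_apply N r c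
    rw [hR g]
    simp only [Matrix.smul_apply, smul_eq_mul, hSwc, Equiv.swap_apply_left,
      Equiv.swap_apply_right,
      Equiv.swap_apply_of_ne_of_ne (by decide : (2 : Fin 3) ≠ 0) (by decide : (2 : Fin 3) ≠ 1),
      h00, h01, h10, h11, h20, h21, mul_zero, mul_one]
    exact ⟨trivial, trivial, trivial, trivial, trivial, trivial⟩
  have hmid : ∀ g, middleBlock (((R * T g * R⁻¹ : GL (Fin 3) (padicAlgClResidueField p)) :
      Matrix (Fin 3) (Fin 3) (padicAlgClResidueField p))) 0 (by norm_num) =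
      !![((R * T g * R⁻¹ : GL (Fin 3) (padicAlgClResidueField p)) : Matrix (Fin 3) (Fin 3) (padicAlgClResidueField p)) 0 0,
         ((R * T g * R⁻¹ : GL (Fin 3) (padicAlgClResidueField p)) : Matrix (Fin 3) (Fin 3) (padicAlgClResidueField p)) 0 1;
         ((R * T g * R⁻¹ : GL (Fin 3) (padicAlgClResidueField p)) : Matrix (Fin 3) (Fin 3) (padicAlgClResidueField p)) 1 0,
         ((R * T g * R⁻¹ : GL (Fin 3) (padicAlgClResidueField p)) : Matrix (Fin 3) (Fin 3) (padicAlgClResidueField p)) 1 1] := by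
    exact fun g => middleBlock_zero_three _ _
  /- STEP 3: the hypotheses of conjunct (ii) at `i = 0`. -/
  have hzero : ∀ (σ : absoluteGaloisGroup K) (r c : Fin 3),
      ((0 ≤ r.val ∧ c.val < 0) ∨ (0 + 2 ≤ r.val ∧ c.val < 0 + 2) ∨ (r.val = 0 + 1 ∧ c.val = 0)) →
        ((R * T σ * R⁻¹ : GL (Fin 3) (padicAlgClResidueField p)) :
          Matrix (Fin 3) (Fin 3) (padicAlgClResidueField p)) r c = 0 := by
    intro σ r c h
    obtain ⟨e10, e20, e21, -, -, -⟩ := hN σ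
    have hr3 := r.isLt
    have hc3 := c.isLt
    rcases h with ⟨-, hc⟩ | ⟨hr, hc⟩ | ⟨hr, hc⟩
    · exact absurd hc (Nat.not_lt_zero _)
    · have hr2 : r = 2 := Fin.ext (by rw [Fin.val_two]; omega)
      subst hr2
      by_cases hc0 : c.val = 0
      · have : c = 0 := Fin.ext (by rw [Fin.val_zero]; exact hc0)
        subst this
        exact e20
      · have : c = 1 := Fin.ext (by rw [Fin.val_one]; omega)
        subst this
        exact e21
    · have hr1 : r = 1 := Fin.ext (by rw [Fin.val_one]; omega)
      have hc0 : c = 0 := Fin.ext (by rw [Fin.val_zero]; omega)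
      subst hr1
      subst hc0
      exact e10
  have hnonsplit : ¬ ∃ Q : GL (Fin 2) (padicAlgClResidueField p),
      ∀ (σ : absoluteGaloisGroup K) (r c : Fin 2), r ≠ c →
        ((Q : Matrix (Fin 2) (Fin 2) (padicAlgClResidueField p)) *
            middleBlock (((R * T σ * R⁻¹ : GL (Fin 3) (padicAlgClResidueField p)) :
              Matrix (Fin 3) (Fin 3) (padicAlgClResidueField p))) 0 (by norm_num) *
            ((Q⁻¹ : GL (Fin 2) (padicAlgClResidueField p)) :
              Matrix (Fin 2) (Fin 2) (padicAlgClResidueField p))) r c = 0 := by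
    rintro ⟨Q, hQ⟩
    apply hne
    obtain ⟨ha, hb, hx⟩ := hwild hu₀ σw hσw
    obtain ⟨e10, -, -, e00, e11, e01⟩ := hN σw
    rw [ha, hb, hx, inv_one, mul_one, one_mul] at e00
    rw [hx] at e11
    rw [hb, hx, inv_one, mul_one, one_mul] at e01
    have hm : middleBlock (((R * T σw * R⁻¹ : GL (Fin 3) (padicAlgClResidueField p)) :
        Matrix (Fin 3) (Fin 3) (padicAlgClResidueField p))) 0 (by norm_num) =
        !![1, -2 * ((P * V σw * P⁻¹ : GL (Fin 2) (padicAlgClResidueField p)) :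
          Matrix (Fin 2) (Fin 2) (padicAlgClResidueField p)) 0 1; 0, 1] := by
      rw [hmid σw, e00, e01, e10, e11]
    have h01 := hQ σw 0 1 (by decide)
    have h10 := hQ σw 1 0 (by decide)
    rw [hm] at h01 h10
    have hc := eq_zero_of_unipotent_conj_diagonal Q _ h01 h10
    have hc' : ((P * V σw * P⁻¹ : GL (Fin 2) (padicAlgClResidueField p)) :
        Matrix (Fin 2) (Fin 2) (padicAlgClResidueField p)) 0 1 = 0 := by
      have : (-2 : padicAlgClResidueField p) ≠ 0 := neg_ne_zero.mpr h2
      exact (mul_eq_zero.mp hc).resolve_left this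
    exact hV1 σw ha hb hc'
  have hmem1 : (1 : ℤ) ∈ ({0, 1, 2} : Multiset ℤ) := by simp
  -- the inertial values of `a`, `b`, `x`
  have hI : ∀ σ : ↥(absInertia K),
      ((R * T (σ : absoluteGaloisGroup K) * R⁻¹ : GL (Fin 3) (padicAlgClResidueField p)) :
          Matrix (Fin 3) (Fin 3) (padicAlgClResidueField p)) 0 0 =
        ((ω σ : (padicAlgClResidueField p)ˣ) : padicAlgClResidueField p)⁻¹ *
          (((ω ^ e) σ : (padicAlgClResidueField p)ˣ) : padicAlgClResidueField p) ∧
      ((R * T (σ : absoluteGaloisGroup K) * R⁻¹ : GL (Fin 3) (padicAlgClResidueField p)) :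
          Matrix (Fin 3) (Fin 3) (padicAlgClResidueField p)) 1 1 =
        ((ω σ : (padicAlgClResidueField p)ˣ) : padicAlgClResidueField p)⁻¹ := by
    intro σ
    obtain ⟨-, -, -, e00, e11, -⟩ := hN σ
    obtain ⟨hb, ha⟩ := hdiag σ
    have hx := hE σ
    rw [← hω] at hx
    refine ⟨?_, by rw [e11, hx, Units.val_inv_eq_inv_val]⟩
    rw [e00, hx, ha, hb, Units.val_inv_eq_inv_val]
    have hω0 : ((ω σ : (padicAlgClResidueField p)ˣ) : padicAlgClResidueField p) ≠ 0 := Units.ne_zero _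
    field_simp
  /- STEP 4: conjunct (ii); `e = -1` is impossible, `e = 1` gives peu ramifié. -/
  rcases he with rfl | rfl
  · -- e = 1 : (a, b) = (1, 0)
    have hmem0 : (0 : ℤ) ∈ ({0, 1, 2} : Multiset ℤ) := by simp
    have hdiagω : ∀ σ : ↥(absInertia K),
        ((R * T (σ : absoluteGaloisGroup K) * R⁻¹ : GL (Fin 3) (padicAlgClResidueField p)) :
            Matrix (Fin 3) (Fin 3) (padicAlgClResidueField p)) ⟨0, by omega⟩ ⟨0, by omega⟩ =
          (((fundamentalCharacter K 1 ι ϖ hϖ) ^ (-(0 : ℤ))) σ : (padicAlgClResidueField p)ˣ) ∧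
        ((R * T (σ : absoluteGaloisGroup K) * R⁻¹ : GL (Fin 3) (padicAlgClResidueField p)) :
            Matrix (Fin 3) (Fin 3) (padicAlgClResidueField p)) ⟨0 + 1, by omega⟩ ⟨0 + 1, by omega⟩ =
          (((fundamentalCharacter K 1 ι ϖ hϖ) ^ (-(1 : ℤ))) σ : (padicAlgClResidueField p)ˣ) := by
      intro σ
      obtain ⟨h0, h1⟩ := hI σ
      rw [← hω]
      refine ⟨?_, ?_⟩
      · change ((R * T (σ : absoluteGaloisGroup K) * R⁻¹ : GL (Fin 3) (padicAlgClResidueField p)) :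
            Matrix (Fin 3) (Fin 3) (padicAlgClResidueField p)) 0 0 = _
        rw [h0]
        simp only [MonoidHom.zpow_apply, neg_zero, zpow_zero, zpow_one, Units.val_one]
        exact inv_mul_cancel₀ (Units.ne_zero _)
      · change ((R * T (σ : absoluteGaloisGroup K) * R⁻¹ : GL (Fin 3) (padicAlgClResidueField p)) :
            Matrix (Fin 3) (Fin 3) (padicAlgClResidueField p)) 1 1 = _
        rw [h1]
        simp only [MonoidHom.zpow_apply, zpow_neg, zpow_one, Units.val_inv_eq_inv_val]
    obtain ⟨-, hpeu⟩ := hFL.2 R 0 (by norm_num) 1 0 hmem1 hmem0 hzero hdiagω hnonsplit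
    have hpeu := hpeu (by norm_num)
    -- the level-one shape with exponent `s`
    refine ⟨s, Or.inl ⟨P, fun σ => ?_, fun u hu σ hσ => ?_⟩⟩
    · obtain ⟨hb, ha⟩ := hdiag σ
      simp only [MonoidHom.zpow_apply, zpow_one] at ha
      have hω0 : ((ω σ : (padicAlgClResidueField p)ˣ) : padicAlgClResidueField p) ≠ 0 := Units.ne_zero _
      refine ⟨((P * V (σ : absoluteGaloisGroup K) * P⁻¹ : GL (Fin 2) (padicAlgClResidueField p)) :
          Matrix (Fin 2) (Fin 2) (padicAlgClResidueField p)) 0 1 *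
            (((ω σ : (padicAlgClResidueField p)ˣ) : padicAlgClResidueField p) ^ s)⁻¹, ?_⟩
      rw [← hω]
      ext i j
      fin_cases i <;> fin_cases j
      · simpa [Units.val_pow_eq_pow_val] using ha
      · simp [Units.val_pow_eq_pow_val]
        rw [mul_left_comm, mul_inv_cancel₀ (pow_ne_zero _ hω0), mul_one]
      · simpa using htri (σ : absoluteGaloisGroup K)
      · simpa [Units.val_pow_eq_pow_val] using hb
    · have hu0 : 0 < u := lt_trans one_pos hu
      obtain ⟨ha, hb, hx⟩ := hwild hu0 σ hσ
      obtain ⟨-, -, -, -, -, e01⟩ := hN σ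
      have hm := hpeu u hu σ hσ
      rw [hmid σ] at hm
      have h01 := congrFun (congrFun hm 0) 1
      simp only [Matrix.of_apply, Matrix.cons_val', Matrix.cons_val_zero, Matrix.cons_val_one,
        Matrix.empty_val', Matrix.cons_val_fin_one,
        Matrix.one_apply_ne (by decide : (0 : Fin 2) ≠ 1)] at h01
      rw [e01, hx, hb, inv_one, mul_one, one_mul] at h01
      have hc' : ((P * V σ * P⁻¹ : GL (Fin 2) (padicAlgClResidueField p)) :
          Matrix (Fin 2) (Fin 2) (padicAlgClResidueField p)) 0 1 = 0 :=
        (mul_eq_zero.mp h01).resolve_left (neg_ne_zero.mpr h2)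
      exact hV1 σ ha hb hc'
  · -- e = -1 : (a, b) = (1, 2), and (ii) would give `2 < 1`
    have hmem2 : (2 : ℤ) ∈ ({0, 1, 2} : Multiset ℤ) := by simp
    have hdiagω : ∀ σ : ↥(absInertia K),
        ((R * T (σ : absoluteGaloisGroup K) * R⁻¹ : GL (Fin 3) (padicAlgClResidueField p)) :
            Matrix (Fin 3) (Fin 3) (padicAlgClResidueField p)) ⟨0, by omega⟩ ⟨0, by omega⟩ =
          (((fundamentalCharacter K 1 ι ϖ hϖ) ^ (-(2 : ℤ))) σ : (padicAlgClResidueField p)ˣ) ∧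
        ((R * T (σ : absoluteGaloisGroup K) * R⁻¹ : GL (Fin 3) (padicAlgClResidueField p)) :
            Matrix (Fin 3) (Fin 3) (padicAlgClResidueField p)) ⟨0 + 1, by omega⟩ ⟨0 + 1, by omega⟩ =
          (((fundamentalCharacter K 1 ι ϖ hϖ) ^ (-(1 : ℤ))) σ : (padicAlgClResidueField p)ˣ) := by
      intro σ
      obtain ⟨h0, h1⟩ := hI σ
      rw [← hω]
      refine ⟨?_, ?_⟩
      · change ((R * T (σ : absoluteGaloisGroup K) * R⁻¹ : GL (Fin 3) (padicAlgClResidueField p)) :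
            Matrix (Fin 3) (Fin 3) (padicAlgClResidueField p)) 0 0 = _
        rw [h0]
        simp only [MonoidHom.zpow_apply, zpow_neg, zpow_one, zpow_two, Units.val_inv_eq_inv_val,
          Units.val_mul, mul_inv]
      · change ((R * T (σ : absoluteGaloisGroup K) * R⁻¹ : GL (Fin 3) (padicAlgClResidueField p)) :
            Matrix (Fin 3) (Fin 3) (padicAlgClResidueField p)) 1 1 = _
        rw [h1]
        simp only [MonoidHom.zpow_apply, zpow_neg, zpow_one, Units.val_inv_eq_inv_val]
    obtain ⟨hlt, -⟩ := hFL.2 R 0 (by norm_num) 1 2 hmem1 hmem2 hzero hdiagω hnonsplit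
    exact absurd hlt (by norm_num)

end Main

end Summit.Langlands.Langlands.Cruxes.AdjointLiftingGL3.Birth

end
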